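import Literature.Computability.AlgebraicComplexity.BI17GenericTensorDegreeMonoidProofs
import Literature.Computability.AlgebraicComplexity.BI17TensorCorollaryBridges
import Literature.Computability.AlgebraicComplexity.BI17GenericPeriodTwoProofs
import Literature.Computability.AlgebraicComplexity.BI17MinimalExponentCorollaryBridge
import Literature.Computability.AlgebraicComplexity.QuantumFunctionalsDegenerationProofs
import Literature.FieldTheory.QuasiAlgClosed.Basic
import Mathlib.RingTheory.RootsOfUnity.Complex
import Mathlib.Algebra.MvPolynomial.Funext
import Mathlib.Data.Set.Card
import Mathlib.Topology.Algebra.MvPolynomial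
import Mathlib.Topology.MetricSpace.Sequences
import Mathlib.Analysis.Normed.Group.Bounded
import HarnessLib

/-!
# Degrees of `SL³`-invariants on `⊗³ℂ^m` are multiples of `m` (BI 2017, Lemma 5.1 / Thm. 5.9(1):
# `m ∣ e(m)`), and `4ℕ ⊆ E(2)` (Rem. 5.4) — PROOFS

P. Bürgisser, C. Ikenmeyer, *Fundamental invariants of orbit closures*, J. Algebra **477** (2017)
390–434 = arXiv:1511.02927 [BurgisserIkenmeyer2017], §5 (TeX `main.tex` L1954–1976: the map
`ι(t) = (t·id, id, id)` with `χ(ι(t)) = t^m`, `ι(t)w = tw`, "hence `ma(w)` equals the degree";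
eq. (5.1)–(5.2) and Rem. 5.4, L2005–2040; Thm. 5.9(1), L2122). THEOREMS ONLY; sibling of the statement
file `BI17FundamentalInvariantTensors.lean` (val-lit row BI2017-B, file of record t04); nothing is
restated, no new named fact.

* `card_dvd_of_mem_genericTensorDegreeMonoid`: every degree `d ∈ E(m)` carrying a nonzero homogeneous
  `SL_m³`-invariant is a multiple of `m` — the scalar `ζ·id ∈ SL_m` (`ζ` a primitive `m`-th root of
  unity) acts on `⊗³ℂ^m` by `ζ`, so `ζ^d F = F`. Hence `m ∣ e(m)`
  (`BI2017_dvd_genericTensorMinimalDegree`, the divisibility half of the typed Thm. 5.9(1); the bound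
  `⌈√m⌉ ≤ e'(m)` is not proved here), and `E(2) ⊆ 2ℕ`.
* `four_mul_mem_genericTensorDegreeMonoid_two`: `4ℕ ⊆ E(2)`, witnessed by the powers of Cayley's
  hyperdeterminant (a degree-4 `SL₂³`-invariant with `Det(⟨2⟩) = 1`, `exists_hyperdet₂₂₂_isSL3Invariant`)
  — the inclusion `⊇` of Rem. 5.4's `E(2) = 4ℕ` (the inclusion `⊆`, i.e. `ℂ[⊗³ℂ²]^{SL₂³} = ℂ[Det]`,
  is not proved here).
* `card_mul_tensorStabilizerPeriod_dvd_of_mem_tensorDegreeMonoid`: `E(w) ⊆ m a(w) ℕ` for a tensor of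
  finite period (`χ(stab w) = μ_{a(w)}`, `tensorStabChiImage_eq_rootsOfUnity`; then the printed
  argument of Lemma 5.1(1) with `gᵢ = tᵢ sᵢ`), hence `m a(w) ∣ e(w)` and the inclusion
  `⟨E(w)⟩ ⊆ m a(w) ℤ` of Thm. 5.3 (`BI2017_thm_5_3_le`; the equality, §6.4, is not proved here);
  and `E(w) ⊆ m a(w) E'(w)` (`BI2017_lem_5_1_3_subset`: `F(w)⁻¹F` has `Φ(gw) = χ(g)^{a e}`), with
  `m a(w) e'(w) ≤ e(w)` (`BI2017_lem_5_1_3_le`).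
* **Rem. 5.4 for the degree monoid, PROVED**: `E(⟨2⟩) = E(2) = 4ℕ`
  (`tensorDegreeMonoid_unitTensor_two`, `BI2017_rem_5_4_genericTensorDegreeMonoid` — via
  `a(⟨2⟩) = 2`, `E(w) ⊆ m a(w)ℕ`, the hyperdeterminant, the dense orbit of `⟨2⟩` and
  `E(w) = E(m)` generically), `e(2) = e(⟨2⟩) = 4`, `e'(⟨2⟩) = 1`; the exponent monoid is an orbit
  invariant (`tensorExponentMonoid_actTensor`), so for almost all `w ∈ ⊗³ℂ²`: `E(w) = 4ℕ`, `e(w) = 4`,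
  `e'(w) = 1` (`BI2017_generic_tensorDegreeMonoid_two`, `BI2017_generic_tensorMinimalExponent_two`).
* **Thm. 5.8(1)** (zero set of `Φ_w` in `\overline{Gw}` = boundary) for polystable `w` with
  `e(w) > 0`: `BI2017_thm_5_8_part1_of_pos` (sequential compactness + closedness of `SL³ w`).

Honest framing: typed-literature proofs for the cell `val-lit`; nothing here bears on VP versus VNP.

## References

* [BurgisserIkenmeyer2017] P. Bürgisser, C. Ikenmeyer, *Fundamental invariants of orbit closures*,
  J. Algebra 477 (2017) 390–434; arXiv:1511.02927, Lemma 5.1, eq. (5.1), Rem. 5.4, Thm. 5.9(1).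
-/

noncomputable section

open MvPolynomial Matrix

namespace Literature.Computability.AlgebraicComplexity

/-! ### `E(m) ⊆ mℕ` -/

section Divisibility

variable {ι : Type*} [Fintype ι] [DecidableEq ι]

omit [Fintype ι] [DecidableEq ι] in
/-- A form of degree `d` on `⊗³ℂ^ι` satisfies `F(ζ w) = ζ^d F(w)`. [folklore] -/
private theorem aeval_tensorPt_smul (ζ : ℂ) {F : MvPolynomial (ι × ι × ι) ℂ} {d : ℕ}
    (hF : F.IsHomogeneous d) (w : ι → ι → ι → ℂ) :
    aeval (tensorPt (ζ • w)) F = ζ ^ d * aeval (tensorPt w) F := by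
  rw [show tensorPt (ζ • w) = ζ • tensorPt w from rfl]
  simp only [MvPolynomial.aeval_eq_eval]
  exact hF.eval_smul_eq ζ (tensorPt w)

/-- **Degrees of nonzero homogeneous `SL_m³`-invariants on `⊗³ℂ^m` are multiples of `m`**
(`E(m) ⊆ m·ℕ`; BI 2017 write `E(m) = m a(m) E'(m)`): the scalar matrix `ζ·id ∈ SL_m`, `ζ` a
primitive `m`-th root of unity, acts on `⊗³ℂ^m` as multiplication by `ζ`, so an invariant form of
degree `d` satisfies `ζ^d F = F`, whence `ζ^d = 1`. [cite: BurgisserIkenmeyer2017, Lemma 5.1(1) and eq. (5.2)] -/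
theorem card_dvd_of_mem_genericTensorDegreeMonoid [Nonempty ι] {d : ℕ}
    (hd : d ∈ genericTensorDegreeMonoid ι ℂ) : Fintype.card ι ∣ d := by
  obtain ⟨F, hFh, hFi, hF0⟩ := hd
  have hζ := Complex.isPrimitiveRoot_exp (Fintype.card ι) Fintype.card_ne_zero
  set ζ := Complex.exp (2 * Real.pi * Complex.I / (Fintype.card ι : ℂ)) with hζdef
  have hdet : (ζ • (1 : Matrix ι ι ℂ)).det = 1 := by
    rw [Matrix.det_smul, Matrix.det_one, mul_one, hζ.pow_eq_one]
  -- invariance under `(ζ·1, 1, 1) ∈ SL³` and homogeneity: `ζ^d F(w) = F(w)`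
  have hscale : ∀ w : ι → ι → ι → ℂ, ζ ^ d * aeval (tensorPt w) F = aeval (tensorPt w) F := by
    intro w
    have h := hFi ⟨ζ • (1 : Matrix ι ι ℂ), hdet⟩ 1 1 w
    rw [Matrix.SpecialLinearGroup.coe_one, Matrix.SpecialLinearGroup.coe_mk, actTensor_smul_one,
      aeval_tensorPt_smul ζ hFh] at h
    exact h
  -- a point where `F ≠ 0`
  obtain ⟨x, hx⟩ : ∃ x, MvPolynomial.eval x F ≠ 0 := by
    by_contra h
    exact hF0 (MvPolynomial.funext fun x => by
      rw [map_zero]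
      exact not_not.1 fun hx => h ⟨x, hx⟩)
  have h1 : ζ ^ d = 1 := by
    have h := hscale fun a b c => x (a, b, c)
    have hxt : tensorPt (fun a b c => x (a, b, c)) = x := funext fun _ => rfl
    rw [hxt] at h
    simp only [MvPolynomial.aeval_eq_eval] at h
    exact (mul_eq_right₀ hx).1 h
  exact (hζ.pow_eq_one_iff_dvd d).1 h1

/-- **BI 2017, Thm. 5.9(1), the divisibility `m ∣ e(m)`** (`e(m) = m a(m) e'(m)` with `a(m) = 1` for
`m > 2`; here for every `m ≥ 1`, with the junk value `e(m) = 0` when `E(m)` has no positive element).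
[cite: BurgisserIkenmeyer2017, Thm. 5.9(1)] -/
theorem BI2017_dvd_genericTensorMinimalDegree (m : ℕ) (hm : 0 < m) :
    m ∣ genericTensorMinimalDegree (Fin m) ℂ := by
  haveI : Nonempty (Fin m) := ⟨⟨0, hm⟩⟩
  unfold genericTensorMinimalDegree
  by_cases hS : ({d | d ∈ genericTensorDegreeMonoid (Fin m) ℂ ∧ 0 < d} : Set ℕ).Nonempty
  · have h := card_dvd_of_mem_genericTensorDegreeMonoid (Nat.sInf_mem hS).1
    rwa [Fintype.card_fin] at h
  · rw [Set.not_nonempty_iff_eq_empty.1 hS, Nat.sInf_empty]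
    exact dvd_zero m

/-- `E(2) ⊆ 2ℕ`. [cite: BurgisserIkenmeyer2017, Rem. 5.4] -/
theorem even_of_mem_genericTensorDegreeMonoid_two {d : ℕ}
    (hd : d ∈ genericTensorDegreeMonoid (Fin 2) ℂ) : 2 ∣ d := by
  have h := card_dvd_of_mem_genericTensorDegreeMonoid hd
  rwa [Fintype.card_fin] at h

end Divisibility

/-! ### `4ℕ ⊆ E(2)`: powers of the hyperdeterminant -/

section HyperdetDegrees

/-- `((A ⊗ 1 ⊗ 1)w)_{abc} = A_{a0} w_{0bc} + A_{a1} w_{1bc}` over `[2]`. [folklore] -/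
private theorem actTensor_fst_apply_two (A : Matrix (Fin 2) (Fin 2) ℂ)
    (w : Fin 2 → Fin 2 → Fin 2 → ℂ) (a b c : Fin 2) :
    actTensor A (1 : Matrix (Fin 2) (Fin 2) ℂ) (1 : Matrix (Fin 2) (Fin 2) ℂ) w a b c =
      A a 0 * w 0 b c + A a 1 * w 1 b c := by
  simp only [actTensor_apply, Matrix.one_apply, mul_ite, mul_one, mul_zero, ite_mul, zero_mul,
    Finset.sum_ite_eq, Finset.mem_univ, if_true, Fin.sum_univ_two]

/-- `((1 ⊗ B ⊗ 1)w)_{abc} = B_{b0} w_{a0c} + B_{b1} w_{a1c}` over `[2]`. [folklore] -/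
private theorem actTensor_snd_apply_two (B : Matrix (Fin 2) (Fin 2) ℂ)
    (w : Fin 2 → Fin 2 → Fin 2 → ℂ) (a b c : Fin 2) :
    actTensor (1 : Matrix (Fin 2) (Fin 2) ℂ) B (1 : Matrix (Fin 2) (Fin 2) ℂ) w a b c =
      B b 0 * w a 0 c + B b 1 * w a 1 c := by
  simp only [actTensor_apply, Matrix.one_apply, mul_ite, mul_one, mul_zero, ite_mul, zero_mul,
    one_mul, Finset.sum_ite_irrel, Finset.sum_const_zero, Finset.sum_ite_eq, Finset.mem_univ,
    if_true, Fin.sum_univ_two]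

/-- `((1 ⊗ 1 ⊗ C)w)_{abc} = C_{c0} w_{ab0} + C_{c1} w_{ab1}` over `[2]`. [folklore] -/
private theorem actTensor_thd_apply_two (C : Matrix (Fin 2) (Fin 2) ℂ)
    (w : Fin 2 → Fin 2 → Fin 2 → ℂ) (a b c : Fin 2) :
    actTensor (1 : Matrix (Fin 2) (Fin 2) ℂ) (1 : Matrix (Fin 2) (Fin 2) ℂ) C w a b c =
      C c 0 * w a b 0 + C c 1 * w a b 1 := by
  simp only [actTensor_apply, Matrix.one_apply, mul_ite, mul_one, mul_zero, ite_mul, zero_mul,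
    one_mul, Finset.sum_ite_irrel, Finset.sum_const_zero, Finset.sum_ite_eq, Finset.mem_univ,
    if_true, Fin.sum_univ_two]

/-- **Cayley's hyperdeterminant is a degree-4 `SL₂³`-invariant with `Det(⟨2⟩) = 1`** (so `4 ∈ E(2)`;
BI 2017 Rem. 5.4: "`E'(2) = ℕ`", `E(2) = m a(2) E'(2) = 4ℕ`). [cite: BurgisserIkenmeyer2017, Rem. 5.4] -/
theorem exists_hyperdet₂₂₂_isSL3Invariant :
    ∃ D : MvPolynomial (Fin 2 × Fin 2 × Fin 2) ℂ,
      D.IsHomogeneous 4 ∧ IsSL3Invariant D ∧ aeval (tensorPt (unitTensor ℂ 2)) D = 1 := by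
  -- the three quadrics `B`, `det M₀`, `det M₁` and `Det = B² - 4 det M₀ det M₁`
  let q₁ : MvPolynomial (Fin 2 × Fin 2 × Fin 2) ℂ :=
    X (0, 0, 0) * X (1, 1, 1) - X (0, 0, 1) * X (1, 1, 0) - X (0, 1, 0) * X (1, 0, 1) +
      X (0, 1, 1) * X (1, 0, 0)
  let q₂ : MvPolynomial (Fin 2 × Fin 2 × Fin 2) ℂ := X (0, 0, 0) * X (0, 1, 1) - X (0, 0, 1) * X (0, 1, 0)
  let q₃ : MvPolynomial (Fin 2 × Fin 2 × Fin 2) ℂ := X (1, 0, 0) * X (1, 1, 1) - X (1, 0, 1) * X (1, 1, 0)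
  let D : MvPolynomial (Fin 2 × Fin 2 × Fin 2) ℂ := q₁ ^ 2 - C 4 * (q₂ * q₃)
  have hXX : ∀ p q : Fin 2 × Fin 2 × Fin 2,
      (X p * X q : MvPolynomial (Fin 2 × Fin 2 × Fin 2) ℂ).IsHomogeneous 2 := fun p q =>
    (isHomogeneous_X ℂ p).mul (isHomogeneous_X ℂ q)
  have hq₁ : q₁.IsHomogeneous 2 := (((hXX _ _).sub (hXX _ _)).sub (hXX _ _)).add (hXX _ _)
  have hq₂ : q₂.IsHomogeneous 2 := (hXX _ _).sub (hXX _ _)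
  have hq₃ : q₃.IsHomogeneous 2 := (hXX _ _).sub (hXX _ _)
  have hDh : D.IsHomogeneous 4 := (hq₁.pow 2).sub ((isHomogeneous_C _ (4 : ℂ)).mul (hq₂.mul hq₃))
  have hD : ∀ w : Fin 2 → Fin 2 → Fin 2 → ℂ, aeval (tensorPt w) D =
      (w 0 0 0 * w 1 1 1 - w 0 0 1 * w 1 1 0 - w 0 1 0 * w 1 0 1 + w 0 1 1 * w 1 0 0) ^ 2 -
        4 * ((w 0 0 0 * w 0 1 1 - w 0 0 1 * w 0 1 0) *
          (w 1 0 0 * w 1 1 1 - w 1 0 1 * w 1 1 0)) := by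
    intro w
    simp only [D, q₁, q₂, q₃, map_sub, map_mul, map_pow, map_add, aeval_X, aeval_C, tensorPt,
      Algebra.algebraMap_self_apply]
  have h1 : ∀ (A : Matrix (Fin 2) (Fin 2) ℂ) (w : Fin 2 → Fin 2 → Fin 2 → ℂ),
      aeval (tensorPt (actTensor A (1 : Matrix (Fin 2) (Fin 2) ℂ) (1 : Matrix (Fin 2) (Fin 2) ℂ) w)) D =
        A.det ^ 2 * aeval (tensorPt w) D := by
    intro A w
    rw [hD, hD, Matrix.det_fin_two]
    simp only [actTensor_fst_apply_two]
    ring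
  have h2 : ∀ (B : Matrix (Fin 2) (Fin 2) ℂ) (w : Fin 2 → Fin 2 → Fin 2 → ℂ),
      aeval (tensorPt (actTensor (1 : Matrix (Fin 2) (Fin 2) ℂ) B (1 : Matrix (Fin 2) (Fin 2) ℂ) w)) D =
        B.det ^ 2 * aeval (tensorPt w) D := by
    intro B w
    rw [hD, hD, Matrix.det_fin_two]
    simp only [actTensor_snd_apply_two]
    ring
  have h3 : ∀ (C : Matrix (Fin 2) (Fin 2) ℂ) (w : Fin 2 → Fin 2 → Fin 2 → ℂ),
      aeval (tensorPt (actTensor (1 : Matrix (Fin 2) (Fin 2) ℂ) (1 : Matrix (Fin 2) (Fin 2) ℂ) C w)) D =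
        C.det ^ 2 * aeval (tensorPt w) D := by
    intro C w
    rw [hD, hD, Matrix.det_fin_two]
    simp only [actTensor_thd_apply_two]
    ring
  refine ⟨D, hDh, fun g₁ g₂ g₃ w => ?_, ?_⟩
  · have hsplit : actTensor (g₁ : Matrix (Fin 2) (Fin 2) ℂ) (g₂ : Matrix (Fin 2) (Fin 2) ℂ)
        (g₃ : Matrix (Fin 2) (Fin 2) ℂ) w =
        actTensor (g₁ : Matrix (Fin 2) (Fin 2) ℂ) (1 : Matrix (Fin 2) (Fin 2) ℂ)
          (1 : Matrix (Fin 2) (Fin 2) ℂ) (actTensor (1 : Matrix (Fin 2) (Fin 2) ℂ)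
            (g₂ : Matrix (Fin 2) (Fin 2) ℂ) (1 : Matrix (Fin 2) (Fin 2) ℂ)
            (actTensor (1 : Matrix (Fin 2) (Fin 2) ℂ) (1 : Matrix (Fin 2) (Fin 2) ℂ)
              (g₃ : Matrix (Fin 2) (Fin 2) ℂ) w)) := by
      rw [actTensor_actTensor, actTensor_actTensor]
      simp only [Matrix.mul_one, Matrix.one_mul]
    rw [hsplit, h1, h2, h3, Matrix.SpecialLinearGroup.det_coe, Matrix.SpecialLinearGroup.det_coe,
      Matrix.SpecialLinearGroup.det_coe]
    ring
  · rw [hD]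
    simp [unitTensor_apply]

/-- **`4ℕ ⊆ E(2)`** (Rem. 5.4: `E(2) = 2·a(2)·E'(2) = 4ℕ`; this is the inclusion `⊇`): `Det^k` is a
nonzero homogeneous `SL₂³`-invariant of degree `4k`. [cite: BurgisserIkenmeyer2017, Rem. 5.4] -/
theorem four_mul_mem_genericTensorDegreeMonoid_two (k : ℕ) :
    4 * k ∈ genericTensorDegreeMonoid (Fin 2) ℂ := by
  obtain ⟨D, hDh, hDi, hD1⟩ := exists_hyperdet₂₂₂_isSL3Invariant
  refine ⟨D ^ k, hDh.pow k, hDi.pow k, pow_ne_zero _ fun h => ?_⟩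
  rw [h, map_zero] at hD1
  exact zero_ne_one hD1

/-- **`e(2) = 4`** would follow from `E(2) = 4ℕ`; unconditionally, `E(2)` has a positive element and
its least positive element `e(2)` satisfies `2 ∣ e(2)` and `0 < e(2) ≤ 4`.
[cite: BurgisserIkenmeyer2017, Rem. 5.4] -/
theorem genericTensorMinimalDegree_two_pos_le :
    0 < genericTensorMinimalDegree (Fin 2) ℂ ∧ genericTensorMinimalDegree (Fin 2) ℂ ≤ 4 := by
  have h4 : (4 : ℕ) ∈ {d | d ∈ genericTensorDegreeMonoid (Fin 2) ℂ ∧ 0 < d} :=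
    ⟨by simpa using four_mul_mem_genericTensorDegreeMonoid_two 1, by norm_num⟩
  unfold genericTensorMinimalDegree
  exact ⟨(Nat.sInf_mem ⟨4, h4⟩).2, Nat.sInf_le h4⟩

end HyperdetDegrees

/-! ### `E(w) ⊆ m a(w) ℕ` (Lemma 5.1 / Thm. 5.3, the inclusion into `m a(w) ℤ`) -/

section PeriodDivisibility

variable {ι : Type*} [Fintype ι] [DecidableEq ι]

omit [DecidableEq ι] in
/-- `(aA ⊗ bB ⊗ cC)·t = (abc)·((A ⊗ B ⊗ C)·t)`. [folklore] -/
private theorem actTensor_smul_smul_smul' (a b c : ℂ) (A B C : Matrix ι ι ℂ) (t : ι → ι → ι → ℂ) :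
    actTensor (a • A) (b • B) (c • C) t = (a * b * c) • actTensor A B C t := by
  funext x y z
  simp only [actTensor_apply, Pi.smul_apply, Matrix.smul_apply, smul_eq_mul, Finset.mul_sum]
  refine Finset.sum_congr rfl fun _ _ => Finset.sum_congr rfl fun _ _ =>
    Finset.sum_congr rfl fun _ _ => by ring

/-- **The image `H = χ(stab(w))` is a subgroup of `ℂ^×`** ("a closed subgroup of `ℂ^×`", §4.1,
L1594): it contains `1` and is closed under products and inverses. [cite: BurgisserIkenmeyer2017, §4.1] -/
theorem tensorStabChiImage_one_mem_mul_mem_inv_mem (w : ι → ι → ι → ℂ) :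
    (1 : ℂˣ) ∈ tensorStabChiImage w ∧
      (∀ {u v : ℂˣ}, u ∈ tensorStabChiImage w → v ∈ tensorStabChiImage w →
        u * v ∈ tensorStabChiImage w) ∧
      ∀ {u : ℂˣ}, u ∈ tensorStabChiImage w → u⁻¹ ∈ tensorStabChiImage w := by
  refine ⟨⟨1, ?_, by simp [tensorChi]⟩, ?_, ?_⟩
  · rw [mem_tensorStab_iff]
    simp only [Prod.fst_one, Prod.snd_one, Units.val_one, actTensor_one]
  · rintro u v ⟨g, hg, rfl⟩ ⟨g', hg', rfl⟩
    refine ⟨g * g', ?_, ?_⟩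
    · rw [mem_tensorStab_iff] at hg hg' ⊢
      simp only [Prod.fst_mul, Prod.snd_mul, Units.val_mul, ← actTensor_actTensor, hg', hg]
    · simp only [tensorChi, Prod.fst_mul, Prod.snd_mul, map_mul]
      simp only [mul_assoc, mul_left_comm]
  · rintro u ⟨g, hg, rfl⟩
    refine ⟨g⁻¹, ?_, ?_⟩
    · rw [mem_tensorStab_iff] at hg ⊢
      conv_lhs => rw [← hg]
      rw [actTensor_actTensor, Prod.fst_inv, Prod.snd_inv, Prod.fst_inv, Prod.snd_inv,
        Units.inv_mul, Units.inv_mul, Units.inv_mul, actTensor_one]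
    · simp only [tensorChi, Prod.fst_inv, Prod.snd_inv, map_inv, mul_inv]

/-- **A finite stabilizer-period group is the group of `a(w)`-th roots of unity**: "Either `H = ℂ^×`
or `H` equals the group `μ_a` of `a`-th roots of unity, where `a = |H|`" (§4.1, L1596) — here the
finite case `0 < a(w)`. [cite: BurgisserIkenmeyer2017, §4.1 (before Def. 4.1)] -/
theorem tensorStabChiImage_eq_rootsOfUnity (w : ι → ι → ι → ℂ) (ha : 0 < tensorStabilizerPeriod w) :
    tensorStabChiImage w = (rootsOfUnity (tensorStabilizerPeriod w) ℂ : Set ℂˣ) := by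
  obtain ⟨h1, hmul, hinv⟩ := tensorStabChiImage_one_mem_mul_mem_inv_mem w
  haveI : NeZero (tensorStabilizerPeriod w) := ⟨ha.ne'⟩
  have hfin : (tensorStabChiImage w).Finite := by
    have := (Nat.card_pos_iff.1 ha).2
    exact Set.toFinite _
  -- `H` as a subgroup, and `h ^ |H| = 1` in it
  let Hs : Subgroup ℂˣ :=
    { carrier := tensorStabChiImage w
      mul_mem' := fun hu hv => hmul hu hv
      one_mem' := h1
      inv_mem' := fun hu => hinv hu }
  have hsub : tensorStabChiImage w ⊆ (rootsOfUnity (tensorStabilizerPeriod w) ℂ : Set ℂˣ) := by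
    intro u hu
    rw [SetLike.mem_coe, mem_rootsOfUnity]
    have hpow : (⟨u, hu⟩ : Hs) ^ Nat.card Hs = 1 := pow_card_eq_one'
    have hval := congrArg Subtype.val hpow
    simp only [SubmonoidClass.coe_pow, OneMemClass.coe_one] at hval
    exact hval
  have hfinR : ((rootsOfUnity (tensorStabilizerPeriod w) ℂ : Subgroup ℂˣ) : Set ℂˣ).Finite := by
    have hF : Finite (rootsOfUnity (tensorStabilizerPeriod w) ℂ) := inferInstance
    exact Set.finite_coe_iff.1 hF
  refine Set.eq_of_subset_of_ncard_le hsub ?_ hfinR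
  rw [← Nat.card_coe_set_eq, ← Nat.card_coe_set_eq, SetLike.coe_sort_coe, Complex.card_rootsOfUnity]
  exact le_rfl

/-- **`E(w) ⊆ m·a(w)·ℕ`** (Lemma 5.1 and Thm. 5.3, the inclusion `⟨E(w)⟩ ⊆ m a(w) ℤ`; BI:
"`E(w) = m a(w) E'(w)`"): if the period `a(w)` is finite (`0 < a(w)`), the degree of a homogeneous
`SL³`-invariant not vanishing on `Gw` is a multiple of `m a(w)`. Proof as printed (Lemma 5.1(1)):
`χ(stab w) = μ_{a}`; for a primitive `ma`-th root of unity `τ`, `τ^m ∈ μ_a = χ(stab w)`, say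
`τ^m = χ(g)` with `g w = w`; writing `gᵢ = tᵢ sᵢ` with `sᵢ ∈ SL` and `t₁t₂t₃ = τ` gives
`F(w) = F(gw) = τ^d F(w)` with `F(w) ≠ 0`, so `τ^d = 1`. [cite: BurgisserIkenmeyer2017, Lemma 5.1 and Thm. 5.3] -/
theorem card_mul_tensorStabilizerPeriod_dvd_of_mem_tensorDegreeMonoid [Nonempty ι]
    (w : ι → ι → ι → ℂ) (ha : 0 < tensorStabilizerPeriod w) {d : ℕ} (hd : d ∈ tensorDegreeMonoid w) :
    Fintype.card ι * tensorStabilizerPeriod w ∣ d := by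
  obtain ⟨F, hFh, hFi, hFI⟩ := hd
  have hFw := aeval_tensorPt_ne_zero_of_not_mem_tensorOrbitVanishingIdeal hFh hFi hFI
  have hm : 0 < Fintype.card ι := Fintype.card_pos
  have hma : Fintype.card ι * tensorStabilizerPeriod w ≠ 0 := (Nat.mul_pos hm ha).ne'
  have hτ := Complex.isPrimitiveRoot_exp _ hma
  set τ := Complex.exp (2 * Real.pi * Complex.I / ((Fintype.card ι * tensorStabilizerPeriod w : ℕ) : ℂ))
    with hτdef
  have hτ0 : τ ≠ 0 := hτ.ne_zero hma
  -- `τ^m ∈ μ_a = χ(stab w)`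
  have hmem : Units.mk0 (τ ^ Fintype.card ι) (pow_ne_zero _ hτ0) ∈ tensorStabChiImage w := by
    rw [tensorStabChiImage_eq_rootsOfUnity w ha, SetLike.mem_coe, mem_rootsOfUnity]
    ext
    rw [Units.val_pow_eq_pow_val, Units.val_mk0, ← pow_mul, hτ.pow_eq_one, Units.val_one]
  obtain ⟨g, hg, hχ⟩ := hmem
  have hχ' : ((g.1 : Matrix ι ι ℂ).det * (g.2.1 : Matrix ι ι ℂ).det) * (g.2.2 : Matrix ι ι ℂ).det =
      τ ^ Fintype.card ι := by
    have := congrArg Units.val hχ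
    simpa only [tensorChi, Units.val_mul, Matrix.GeneralLinearGroup.val_det_apply, Units.val_mk0]
      using this
  -- roots `t₂, t₃` of `det g₂, det g₃` and `t₁ := τ / (t₂ t₃)`
  have hd2 : (g.2.1 : Matrix ι ι ℂ).det ≠ 0 := by
    rw [← Matrix.GeneralLinearGroup.val_det_apply]; exact Units.ne_zero _
  have hd3 : (g.2.2 : Matrix ι ι ℂ).det ≠ 0 := by
    rw [← Matrix.GeneralLinearGroup.val_det_apply]; exact Units.ne_zero _
  obtain ⟨t₂, ht₂⟩ := IsAlgClosed.exists_pow_nat_eq (g.2.1 : Matrix ι ι ℂ).det hm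
  obtain ⟨t₃, ht₃⟩ := IsAlgClosed.exists_pow_nat_eq (g.2.2 : Matrix ι ι ℂ).det hm
  have ht₂0 : t₂ ≠ 0 := by rintro rfl; rw [zero_pow hm.ne'] at ht₂; exact hd2 ht₂.symm
  have ht₃0 : t₃ ≠ 0 := by rintro rfl; rw [zero_pow hm.ne'] at ht₃; exact hd3 ht₃.symm
  set t₁ := τ * (t₂ * t₃)⁻¹ with ht₁def
  have ht₁ : t₁ ^ Fintype.card ι = (g.1 : Matrix ι ι ℂ).det := by
    rw [ht₁def, mul_pow, inv_pow, mul_pow, ht₂, ht₃, ← hχ']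
    field_simp
  have ht₁0 : t₁ ≠ 0 := mul_ne_zero hτ0 (inv_ne_zero (mul_ne_zero ht₂0 ht₃0))
  have hprod : t₁ * t₂ * t₃ = τ := by
    rw [ht₁def]; field_simp
  -- `gᵢ = tᵢ sᵢ` with `sᵢ ∈ SL`
  have mkSL : ∀ (u : GL ι ℂ) (t : ℂ), t ≠ 0 → t ^ Fintype.card ι = (u : Matrix ι ι ℂ).det →
      ∃ s : Matrix.SpecialLinearGroup ι ℂ, (u : Matrix ι ι ℂ) = t • (s : Matrix ι ι ℂ) := by
    intro u t ht0 ht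
    refine ⟨⟨t⁻¹ • (u : Matrix ι ι ℂ), ?_⟩, ?_⟩
    · rw [Matrix.det_smul, ← ht, inv_pow, inv_mul_cancel₀ (pow_ne_zero _ ht0)]
    · change (u : Matrix ι ι ℂ) = t • (t⁻¹ • (u : Matrix ι ι ℂ))
      rw [smul_smul, mul_inv_cancel₀ ht0, one_smul]
  obtain ⟨s₁, hs₁⟩ := mkSL g.1 t₁ ht₁0 ht₁
  obtain ⟨s₂, hs₂⟩ := mkSL g.2.1 t₂ ht₂0 ht₂
  obtain ⟨s₃, hs₃⟩ := mkSL g.2.2 t₃ ht₃0 ht₃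
  -- `F(w) = F(g w) = τ^d F(w)`
  have hkey : τ ^ d * aeval (tensorPt w) F = aeval (tensorPt w) F := by
    have hgw := (mem_tensorStab_iff w g).1 hg
    conv_rhs => rw [← hgw, hs₁, hs₂, hs₃, actTensor_smul_smul_smul', hprod]
    rw [show tensorPt (τ • actTensor (s₁ : Matrix ι ι ℂ) (s₂ : Matrix ι ι ℂ) (s₃ : Matrix ι ι ℂ) w) =
        τ • tensorPt (actTensor (s₁ : Matrix ι ι ℂ) (s₂ : Matrix ι ι ℂ) (s₃ : Matrix ι ι ℂ) w)
        from rfl]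
    simp only [MvPolynomial.aeval_eq_eval]
    rw [hFh.eval_smul_eq, ← MvPolynomial.aeval_eq_eval, ← MvPolynomial.aeval_eq_eval, hFi s₁ s₂ s₃ w]
  have h1 : τ ^ d = 1 := (mul_eq_right₀ hFw).1 hkey
  exact (hτ.pow_eq_one_iff_dvd d).1 h1

/-- **`m a(w) ∣ e(w)`** for a tensor of finite period (Lemma 5.1(3): `e(w) = m a(w) e'(w)`).
[cite: BurgisserIkenmeyer2017, Lemma 5.1(3)] -/
theorem card_mul_tensorStabilizerPeriod_dvd_tensorMinimalDegree [Nonempty ι]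
    (w : ι → ι → ι → ℂ) (ha : 0 < tensorStabilizerPeriod w) :
    Fintype.card ι * tensorStabilizerPeriod w ∣ tensorMinimalDegree w := by
  unfold tensorMinimalDegree
  by_cases hS : ({d | d ∈ tensorDegreeMonoid w ∧ 0 < d} : Set ℕ).Nonempty
  · exact card_mul_tensorStabilizerPeriod_dvd_of_mem_tensorDegreeMonoid w ha (Nat.sInf_mem hS).1
  · rw [Set.not_nonempty_iff_eq_empty.1 hS, Nat.sInf_empty]
    exact dvd_zero _

/-- **BI 2017, Thm. 5.3, the inclusion `⟨E(w)⟩ ⊆ m a(w) ℤ`** ("The degree monoid `E(w)` generates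
the group `m a(w) ℤ`"; the reverse inclusion, §6.4, is not proved here), for `w ∈ ⊗³ℂ^m` of finite
period, `m ≥ 1`. [cite: BurgisserIkenmeyer2017, Thm. 5.3] -/
theorem BI2017_thm_5_3_le (m : ℕ) (hm : 0 < m) (w : Fin m → Fin m → Fin m → ℂ)
    (ha : 0 < tensorStabilizerPeriod w) :
    AddSubgroup.closure ((fun d : ℕ => (d : ℤ)) '' tensorDegreeMonoid w) ≤
      AddSubgroup.zmultiples ((m * tensorStabilizerPeriod w : ℕ) : ℤ) := by
  haveI : Nonempty (Fin m) := ⟨⟨0, hm⟩⟩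
  rw [AddSubgroup.closure_le]
  rintro _ ⟨d, hd, rfl⟩
  rw [SetLike.mem_coe, AddSubgroup.mem_zmultiples_iff]
  obtain ⟨k, hk⟩ := card_mul_tensorStabilizerPeriod_dvd_of_mem_tensorDegreeMonoid w ha hd
  refine ⟨(k : ℤ), ?_⟩
  rw [hk, Fintype.card_fin]
  push_cast
  ring

/-- `GL = (ℂ^× · 1) · SL` over `ℂ`: every `u ∈ GL(ι, ℂ)` is `t • s` with `s ∈ SL`, `t^m = det u`
(`m = |ι|`), for ANY prescribed `m`-th root `t` of `det u`. [folklore] -/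
private theorem exists_sl_eq_smul (u : GL ι ℂ) {t : ℂ} (ht0 : t ≠ 0)
    (ht : t ^ Fintype.card ι = (u : Matrix ι ι ℂ).det) :
    ∃ s : Matrix.SpecialLinearGroup ι ℂ, (u : Matrix ι ι ℂ) = t • (s : Matrix ι ι ℂ) := by
  refine ⟨⟨t⁻¹ • (u : Matrix ι ι ℂ), ?_⟩, ?_⟩
  · rw [Matrix.det_smul, ← ht, inv_pow, inv_mul_cancel₀ (pow_ne_zero _ ht0)]
  · change (u : Matrix ι ι ℂ) = t • (t⁻¹ • (u : Matrix ι ι ℂ))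
    rw [smul_smul, mul_inv_cancel₀ ht0, one_smul]

/-- **`E(w) ⊆ m a(w) E'(w)`** (Lemma 5.1(3) "`E(w) = m a(w) E'(w)`", the inclusion `⊆`): a homogeneous
`SL³`-invariant `F ∉ I(Gw)` has degree `d = m a(w) e` (above), and then `Φ := F(w)⁻¹ F` satisfies
`Φ(g w) = χ(g)^{a(w) e}` for all `g ∈ GL³` (writing `gᵢ = tᵢ sᵢ`: `F(gw) = (t₁t₂t₃)^{m a e} F(w) =
χ(g)^{a e} F(w)`), i.e. `(φ_w)^e` extends to the polynomial function `Φ`: `e ∈ E'(w)`.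
[cite: BurgisserIkenmeyer2017, Lemma 5.1(3)] -/
theorem exists_eq_mul_mem_tensorExponentMonoid_of_mem_tensorDegreeMonoid [Nonempty ι]
    (w : ι → ι → ι → ℂ) (ha : 0 < tensorStabilizerPeriod w) {d : ℕ} (hd : d ∈ tensorDegreeMonoid w) :
    ∃ e : ℕ, d = Fintype.card ι * tensorStabilizerPeriod w * e ∧ e ∈ tensorExponentMonoid w := by
  obtain ⟨e, he⟩ := card_mul_tensorStabilizerPeriod_dvd_of_mem_tensorDegreeMonoid w ha hd
  refine ⟨e, he, ?_⟩
  obtain ⟨F, hFh, hFi, hFI⟩ := hd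
  have hFw := aeval_tensorPt_ne_zero_of_not_mem_tensorOrbitVanishingIdeal hFh hFi hFI
  have hm : 0 < Fintype.card ι := Fintype.card_pos
  refine ⟨C (aeval (tensorPt w) F)⁻¹ * F, fun g => ?_⟩
  -- roots `tᵢ^m = det gᵢ`
  have hdet : ∀ u : GL ι ℂ, (u : Matrix ι ι ℂ).det ≠ 0 := fun u => by
    rw [← Matrix.GeneralLinearGroup.val_det_apply]; exact Units.ne_zero _
  obtain ⟨t₁, ht₁⟩ := IsAlgClosed.exists_pow_nat_eq (g.1 : Matrix ι ι ℂ).det hm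
  obtain ⟨t₂, ht₂⟩ := IsAlgClosed.exists_pow_nat_eq (g.2.1 : Matrix ι ι ℂ).det hm
  obtain ⟨t₃, ht₃⟩ := IsAlgClosed.exists_pow_nat_eq (g.2.2 : Matrix ι ι ℂ).det hm
  have ht₁0 : t₁ ≠ 0 := by rintro rfl; rw [zero_pow hm.ne'] at ht₁; exact hdet _ ht₁.symm
  have ht₂0 : t₂ ≠ 0 := by rintro rfl; rw [zero_pow hm.ne'] at ht₂; exact hdet _ ht₂.symm
  have ht₃0 : t₃ ≠ 0 := by rintro rfl; rw [zero_pow hm.ne'] at ht₃; exact hdet _ ht₃.symm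
  obtain ⟨s₁, hs₁⟩ := exists_sl_eq_smul g.1 ht₁0 ht₁
  obtain ⟨s₂, hs₂⟩ := exists_sl_eq_smul g.2.1 ht₂0 ht₂
  obtain ⟨s₃, hs₃⟩ := exists_sl_eq_smul g.2.2 ht₃0 ht₃
  -- `χ(g)^{a e} = (t₁t₂t₃)^d`
  have hchi : ((tensorChi g : ℂˣ) : ℂ) ^ (tensorStabilizerPeriod w * e) = (t₁ * t₂ * t₃) ^ d := by
    simp only [tensorChi, Units.val_mul, Matrix.GeneralLinearGroup.val_det_apply]
    rw [← ht₁, ← ht₂, ← ht₃, he]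
    ring
  rw [map_mul, aeval_C, Algebra.algebraMap_self_apply, hs₁, hs₂, hs₃, actTensor_smul_smul_smul',
    show tensorPt ((t₁ * t₂ * t₃) • actTensor (s₁ : Matrix ι ι ℂ) (s₂ : Matrix ι ι ℂ)
        (s₃ : Matrix ι ι ℂ) w) =
      (t₁ * t₂ * t₃) • tensorPt (actTensor (s₁ : Matrix ι ι ℂ) (s₂ : Matrix ι ι ℂ) (s₃ : Matrix ι ι ℂ) w)
      from rfl]
  simp only [MvPolynomial.aeval_eq_eval]
  rw [hFh.eval_smul_eq, ← MvPolynomial.aeval_eq_eval, ← MvPolynomial.aeval_eq_eval, hFi s₁ s₂ s₃ w,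
    hchi, mul_comm ((t₁ * t₂ * t₃) ^ d) _, ← mul_assoc, inv_mul_cancel₀ hFw, one_mul]

/-- **BI 2017, Lemma 5.1(3), the inclusion `E(w) ⊆ m a(w) E'(w)`** for `w ∈ ⊗³ℂ^m` of finite period
(`m ≥ 1`), in the shape of the typed `BI2017_lem_5_1_3` (whose equality and `e(w) = m a(w) e'(w)` are
not proved here). [cite: BurgisserIkenmeyer2017, Lemma 5.1(3)] -/
theorem BI2017_lem_5_1_3_subset (m : ℕ) (hm : 0 < m) (w : Fin m → Fin m → Fin m → ℂ)
    (ha : 0 < tensorStabilizerPeriod w) :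
    tensorDegreeMonoid w ⊆ (fun e => m * tensorStabilizerPeriod w * e) '' tensorExponentMonoid w := by
  haveI : Nonempty (Fin m) := ⟨⟨0, hm⟩⟩
  intro d hd
  obtain ⟨e, he, hmem⟩ := exists_eq_mul_mem_tensorExponentMonoid_of_mem_tensorDegreeMonoid w ha hd
  rw [Fintype.card_fin] at he
  exact ⟨e, hmem, he.symm⟩

/-- **`m a(w) e'(w) ≤ e(w)`** (one inequality of Lemma 5.1(3) "`e(w) = m a(w) e'(w)`"), whenever
`E(w)` has a positive element. [cite: BurgisserIkenmeyer2017, Lemma 5.1(3)] -/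
theorem BI2017_lem_5_1_3_le (m : ℕ) (hm : 0 < m) (w : Fin m → Fin m → Fin m → ℂ)
    (ha : 0 < tensorStabilizerPeriod w) (he : 0 < tensorMinimalDegree w) :
    m * tensorStabilizerPeriod w * tensorMinimalExponent w ≤ tensorMinimalDegree w := by
  haveI : Nonempty (Fin m) := ⟨⟨0, hm⟩⟩
  have hmem : tensorMinimalDegree w ∈ {d | d ∈ tensorDegreeMonoid w ∧ 0 < d} :=
    Nat.sInf_mem (Nat.nonempty_of_pos_sInf he)
  obtain ⟨e, hE, heE⟩ :=
    exists_eq_mul_mem_tensorExponentMonoid_of_mem_tensorDegreeMonoid w ha hmem.1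
  rw [Fintype.card_fin] at hE
  have he0 : 0 < e := by
    rcases Nat.eq_zero_or_pos e with rfl | h
    · rw [mul_zero] at hE; exact absurd hE he.ne'
    · exact h
  have hle : tensorMinimalExponent w ≤ e := Nat.sInf_le ⟨heE, he0⟩
  calc m * tensorStabilizerPeriod w * tensorMinimalExponent w
      ≤ m * tensorStabilizerPeriod w * e := Nat.mul_le_mul_left _ hle
    _ = tensorMinimalDegree w := hE.symm

end PeriodDivisibility

/-! ### `E(⟨2⟩) = E(2) = 4ℕ`, `e(2) = e(⟨2⟩) = 4`, `e'(⟨2⟩) = 1` (Rem. 5.4 for the degree monoid) -/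

section DegreeMonoidTwo

variable {ι : Type*} [Fintype ι] [DecidableEq ι]

/-- Points of one orbit have the same degree monoid (`I(G·w) = I(G·u)`).
[cite: BurgisserIkenmeyer2017, Def. 5.2] -/
theorem tensorDegreeMonoid_eq_of_mem {u w : ι → ι → ι → ℂ} (hw : w ∈ tensorGLOrbit u) :
    tensorDegreeMonoid w = tensorDegreeMonoid u := by
  simp only [tensorDegreeMonoid, tensorOrbitVanishingIdeal_eq_of_mem hw]

omit [Fintype ι] [DecidableEq ι] in
/-- Two generic properties hold simultaneously somewhere (`ℂ` is infinite: a product of two nonzero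
polynomials does not vanish identically). [cite: BurgisserIkenmeyer2017, §4.1 ("almost all")] -/
theorem exists_of_isZariskiGenericTensor_and {P Q : (ι → ι → ι → ℂ) → Prop}
    (hP : IsZariskiGenericTensor P) (hQ : IsZariskiGenericTensor Q) : ∃ w, P w ∧ Q w := by
  obtain ⟨F, hF, hPF⟩ := hP
  obtain ⟨G, hG, hQG⟩ := hQ
  have hFG : F * G ≠ 0 := mul_ne_zero hF hG
  obtain ⟨x, hx⟩ : ∃ x, MvPolynomial.eval x (F * G) ≠ 0 := by
    by_contra h
    exact hFG (MvPolynomial.funext fun x => by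
      rw [map_zero]
      exact not_not.1 fun hx => h ⟨x, hx⟩)
  rw [map_mul] at hx
  have hxt : tensorPt (fun a b c => x (a, b, c)) = x := funext fun _ => rfl
  refine ⟨fun a b c => x (a, b, c), hPF _ ?_, hQG _ ?_⟩
  · rw [hxt]; simpa only [MvPolynomial.aeval_eq_eval] using left_ne_zero_of_mul hx
  · rw [hxt]; simpa only [MvPolynomial.aeval_eq_eval] using right_ne_zero_of_mul hx

/-- **`E(⟨2⟩) = 4ℕ`**: `⊆` since `m a(⟨2⟩) = 2·2 = 4` divides every degree in `E(⟨2⟩)` (Thm. 4.3(2)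
and `E(w) ⊆ m a(w) ℕ`); `⊇` by the powers of the hyperdeterminant, `Det(⟨2⟩) = 1`.
[cite: BurgisserIkenmeyer2017, Rem. 5.4] -/
theorem tensorDegreeMonoid_unitTensor_two : tensorDegreeMonoid (unitTensor ℂ 2) = {d | 4 ∣ d} := by
  have ha : tensorStabilizerPeriod (unitTensor ℂ 2) = 2 := (BI2017_thm_4_3_holds 2).2 (by norm_num)
  ext d
  constructor
  · intro hd
    have h := card_mul_tensorStabilizerPeriod_dvd_of_mem_tensorDegreeMonoid (unitTensor ℂ 2)
      (by rw [ha]; exact two_pos) hd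
    rwa [ha, Fintype.card_fin] at h
  · rintro ⟨k, rfl⟩
    obtain ⟨D, hDh, hDi, hD1⟩ := exists_hyperdet₂₂₂_isSL3Invariant
    exact mem_tensorDegreeMonoid_of_aeval_ne_zero (hDh.pow k) (hDi.pow k)
      (by rw [map_pow, hD1, one_pow]; exact one_ne_zero)

/-- **BI 2017, Rem. 5.4, the degree monoid: `E(2) = 4ℕ`** ("`{δ ∈ ℕ | k_2(δ) > 0} = 2E'(2) = 2ℕ`",
i.e. `E(2) = 2 a(2) E'(2) = 4ℕ`) — PROVED: a generic `w ∈ ⊗³ℂ²` has `E(w) = E(2)`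
(`BI2017_tensorDegreeMonoid_generic_holds`) and lies in `GL₂³·⟨2⟩`
(`isZariskiGenericTensor_mem_tensorGLOrbit_unitTensor_two`), and `E(g·⟨2⟩) = E(⟨2⟩) = 4ℕ`. (The
first clause of the typed `BI2017_rem_5_4`, `k_2(δ) = [δ even]`, is not proved here.)
[cite: BurgisserIkenmeyer2017, Rem. 5.4] -/
theorem BI2017_rem_5_4_genericTensorDegreeMonoid :
    genericTensorDegreeMonoid (Fin 2) ℂ = {d | 4 ∣ d} := by
  obtain ⟨w, ⟨hE, -⟩, hw⟩ := exists_of_isZariskiGenericTensor_and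
    (BI2017_tensorDegreeMonoid_generic_holds 2) isZariskiGenericTensor_mem_tensorGLOrbit_unitTensor_two
  rw [← hE, tensorDegreeMonoid_eq_of_mem hw, tensorDegreeMonoid_unitTensor_two]

/-- The least positive multiple of `4` is `4`. [folklore] -/
private theorem sInf_four_dvd_pos : sInf {d : ℕ | d ∈ {d : ℕ | 4 ∣ d} ∧ 0 < d} = 4 := by
  apply le_antisymm
  · exact Nat.sInf_le ⟨dvd_rfl, by norm_num⟩
  · have hne : ({d : ℕ | d ∈ {d : ℕ | 4 ∣ d} ∧ 0 < d} : Set ℕ).Nonempty := ⟨4, dvd_rfl, by norm_num⟩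
    obtain ⟨⟨k, hk⟩, hpos⟩ := Nat.sInf_mem hne
    omega

/-- **`e(2) = 4`** (Rem. 5.4). [cite: BurgisserIkenmeyer2017, Rem. 5.4] -/
theorem BI2017_genericTensorMinimalDegree_two : genericTensorMinimalDegree (Fin 2) ℂ = 4 := by
  unfold genericTensorMinimalDegree
  rw [BI2017_rem_5_4_genericTensorDegreeMonoid]
  exact sInf_four_dvd_pos

/-- **`e(⟨2⟩) = 4`**. [cite: BurgisserIkenmeyer2017, Rem. 5.4] -/
theorem tensorMinimalDegree_unitTensor_two : tensorMinimalDegree (unitTensor ℂ 2) = 4 := by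
  unfold tensorMinimalDegree
  rw [tensorDegreeMonoid_unitTensor_two]
  exact sInf_four_dvd_pos

/-- **`e'(⟨2⟩) = 1`** (Cor. 5.25(1) for `m = 2` with equality; Rem. 5.4 "`E'(2) = ℕ`"): from
`e(⟨2⟩) = 4 ≥ m a(⟨2⟩) e'(⟨2⟩) = 4 e'(⟨2⟩)` and `e'(⟨2⟩) ≥ 1`. [cite: BurgisserIkenmeyer2017, Rem. 5.4] -/
theorem tensorMinimalExponent_unitTensor_two : tensorMinimalExponent (unitTensor ℂ 2) = 1 := by
  have ha : tensorStabilizerPeriod (unitTensor ℂ 2) = 2 := (BI2017_thm_4_3_holds 2).2 (by norm_num)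
  have hle := BI2017_lem_5_1_3_le 2 two_pos (unitTensor ℂ 2) (by rw [ha]; exact two_pos)
    (by rw [tensorMinimalDegree_unitTensor_two]; norm_num)
  rw [ha, tensorMinimalDegree_unitTensor_two] at hle
  have h1 := one_le_tensorMinimalExponent_unitTensor_two
  omega

end DegreeMonoidTwo

/-! ### Orbit invariance of the exponent monoid `E'(w)`; for almost all `w ∈ ⊗³ℂ²`: `e(w) = 4`,
`e'(w) = 1` -/

section ExponentMonoidOrbit

variable {ι : Type*} [Fintype ι] [DecidableEq ι]

omit [DecidableEq ι] in
/-- The pull-back of a polynomial function along the linear map `v ↦ (A₁ ⊗ A₂ ⊗ A₃)·v` is a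
polynomial function (substitute the linear forms `∑ A₁[a,a'] A₂[b,b'] A₃[c,c'] X_{a'b'c'}`).
[folklore] -/
private theorem exists_aeval_eq_aeval_actTensor (A₁ A₂ A₃ : Matrix ι ι ℂ)
    (F : MvPolynomial (ι × ι × ι) ℂ) :
    ∃ F' : MvPolynomial (ι × ι × ι) ℂ, ∀ v : ι → ι → ι → ℂ,
      aeval (tensorPt v) F' = aeval (tensorPt (actTensor A₁ A₂ A₃ v)) F := by
  refine ⟨bind₁ (fun p : ι × ι × ι => ∑ q : ι × ι × ι,
      C (A₁ p.1 q.1 * A₂ p.2.1 q.2.1 * A₃ p.2.2 q.2.2) * X q) F, fun v => ?_⟩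
  have hpt : (fun p : ι × ι × ι => aeval (tensorPt v)
      (∑ q : ι × ι × ι, C (A₁ p.1 q.1 * A₂ p.2.1 q.2.1 * A₃ p.2.2 q.2.2) * X q)) =
      tensorPt (actTensor A₁ A₂ A₃ v) := by
    funext p
    simp only [map_sum, map_mul, aeval_C, aeval_X, Algebra.algebraMap_self_apply, tensorPt,
      actTensor_apply, Fintype.sum_prod_type]
  rw [aeval_bind₁, hpt]

/-- **The exponent monoid is a `GL³`-orbit invariant**: `E'(g·u) = E'(u)` (with `a(g·u) = a(u)`:
if `F(h u) = χ(h)^{a e}` for all `h`, then `F'(v) := F(g⁻¹ v)` has `F'(h g u) = χ(g⁻¹ h g)^{a e}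
= χ(h)^{a e}`). [cite: BurgisserIkenmeyer2017, §5 (after Thm. 5.3)] -/
theorem tensorExponentMonoid_actTensor (g : GL ι ℂ × GL ι ℂ × GL ι ℂ) (u : ι → ι → ι → ℂ) :
    tensorExponentMonoid (actTensor (g.1 : Matrix ι ι ℂ) (g.2.1 : Matrix ι ι ℂ) (g.2.2 : Matrix ι ι ℂ) u) =
      tensorExponentMonoid u := by
  suffices h : ∀ (g : GL ι ℂ × GL ι ℂ × GL ι ℂ) (u : ι → ι → ι → ℂ), tensorExponentMonoid u ⊆
      tensorExponentMonoid
        (actTensor (g.1 : Matrix ι ι ℂ) (g.2.1 : Matrix ι ι ℂ) (g.2.2 : Matrix ι ι ℂ) u) by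
    refine Set.Subset.antisymm ?_ (h g u)
    have h' := h g⁻¹ (actTensor (g.1 : Matrix ι ι ℂ) (g.2.1 : Matrix ι ι ℂ) (g.2.2 : Matrix ι ι ℂ) u)
    rwa [Prod.fst_inv, Prod.snd_inv, Prod.fst_inv, Prod.snd_inv, actTensor_actTensor, Units.inv_mul,
      Units.inv_mul, Units.inv_mul, actTensor_one] at h'
  rintro g u e ⟨F, hF⟩
  obtain ⟨F', hF'⟩ := exists_aeval_eq_aeval_actTensor ((g.1⁻¹ : GL ι ℂ) : Matrix ι ι ℂ)
    ((g.2.1⁻¹ : GL ι ℂ) : Matrix ι ι ℂ) ((g.2.2⁻¹ : GL ι ℂ) : Matrix ι ι ℂ) F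
  refine ⟨F', fun h => ?_⟩
  rw [tensorStabilizerPeriod_actTensor, hF', actTensor_actTensor, actTensor_actTensor]
  have hh := hF (g⁻¹ * h * g)
  rw [tensorChi_conj] at hh
  simp only [Prod.fst_mul, Prod.snd_mul, Prod.fst_inv, Prod.snd_inv, Units.val_mul,
    Matrix.mul_assoc] at hh ⊢
  exact hh

/-- **`e'(g·u) = e'(u)`**. [cite: BurgisserIkenmeyer2017, §5 (after Thm. 5.3)] -/
theorem tensorMinimalExponent_actTensor (g : GL ι ℂ × GL ι ℂ × GL ι ℂ) (u : ι → ι → ι → ℂ) :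
    tensorMinimalExponent (actTensor (g.1 : Matrix ι ι ℂ) (g.2.1 : Matrix ι ι ℂ) (g.2.2 : Matrix ι ι ℂ) u) =
      tensorMinimalExponent u := by
  unfold tensorMinimalExponent
  rw [tensorExponentMonoid_actTensor]

/-- **For almost all `w ∈ ⊗³ℂ²`: `E(w) = 4ℕ` and `e(w) = 4`** (Rem. 5.4 with `E(w) = E(m)`
generically). [cite: BurgisserIkenmeyer2017, Rem. 5.4] -/
theorem BI2017_generic_tensorDegreeMonoid_two :
    IsZariskiGenericTensor fun w : Fin 2 → Fin 2 → Fin 2 → ℂ =>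
      tensorDegreeMonoid w = {d | 4 ∣ d} ∧ tensorMinimalDegree w = 4 := by
  refine (BI2017_tensorDegreeMonoid_generic_holds 2).mono fun w hw => ?_
  rw [hw.1, hw.2, BI2017_rem_5_4_genericTensorDegreeMonoid, BI2017_genericTensorMinimalDegree_two]
  exact ⟨rfl, rfl⟩

/-- **For almost all `w ∈ ⊗³ℂ²`: `e'(w) = 1`** ("`e'(2) = 1`": Rem. 5.4 "`2E'(2) = 2ℕ`"; generic
`w ∈ GL₂³·⟨2⟩` and `e'(⟨2⟩) = 1`). [cite: BurgisserIkenmeyer2017, Rem. 5.4] -/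
theorem BI2017_generic_tensorMinimalExponent_two :
    IsZariskiGenericTensor fun w : Fin 2 → Fin 2 → Fin 2 → ℂ => tensorMinimalExponent w = 1 := by
  refine isZariskiGenericTensor_mem_tensorGLOrbit_unitTensor_two.mono fun w hw => ?_
  obtain ⟨g, rfl⟩ := hw
  rw [tensorMinimalExponent_actTensor, tensorMinimalExponent_unitTensor_two]

end ExponentMonoidOrbit

/-! ### Thm. 5.8(1): the zero set of `Φ_w` in `\overline{Gw}` is the boundary (when `e(w) > 0`) -/

section FundamentalInvariantZeroSet

open Filter Topology

variable {ι : Type*} [Fintype ι] [DecidableEq ι]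

/-- Every `g ∈ GL³(ℂ)` acts as `τ` times an element of `SL³`: `g·w = τ (s·w)` with `τ ≠ 0`.
[folklore] -/
private theorem exists_actTensor_eq_smul_sl [Nonempty ι] (g : GL ι ℂ × GL ι ℂ × GL ι ℂ)
    (w : ι → ι → ι → ℂ) :
    ∃ (τ : ℂ) (s : Matrix.SpecialLinearGroup ι ℂ × Matrix.SpecialLinearGroup ι ℂ ×
        Matrix.SpecialLinearGroup ι ℂ), τ ≠ 0 ∧
      actTensor (g.1 : Matrix ι ι ℂ) (g.2.1 : Matrix ι ι ℂ) (g.2.2 : Matrix ι ι ℂ) w =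
        τ • actTensor (s.1 : Matrix ι ι ℂ) (s.2.1 : Matrix ι ι ℂ) (s.2.2 : Matrix ι ι ℂ) w := by
  have hm : 0 < Fintype.card ι := Fintype.card_pos
  have hdet : ∀ u : GL ι ℂ, (u : Matrix ι ι ℂ).det ≠ 0 := fun u => by
    rw [← Matrix.GeneralLinearGroup.val_det_apply]; exact Units.ne_zero _
  have root : ∀ u : GL ι ℂ, ∃ (t : ℂ) (s : Matrix.SpecialLinearGroup ι ℂ),
      t ≠ 0 ∧ (u : Matrix ι ι ℂ) = t • (s : Matrix ι ι ℂ) := by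
    intro u
    obtain ⟨t, ht⟩ := IsAlgClosed.exists_pow_nat_eq (u : Matrix ι ι ℂ).det hm
    have ht0 : t ≠ 0 := by rintro rfl; rw [zero_pow hm.ne'] at ht; exact hdet u ht.symm
    obtain ⟨s, hs⟩ := exists_sl_eq_smul u ht0 ht
    exact ⟨t, s, ht0, hs⟩
  obtain ⟨t₁, s₁, h₁, hg₁⟩ := root g.1
  obtain ⟨t₂, s₂, h₂, hg₂⟩ := root g.2.1
  obtain ⟨t₃, s₃, h₃, hg₃⟩ := root g.2.2
  exact ⟨t₁ * t₂ * t₃, (s₁, s₂, s₃), mul_ne_zero (mul_ne_zero h₁ h₂) h₃,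
    by rw [hg₁, hg₂, hg₃, actTensor_smul_smul_smul']⟩

/-- **BI 2017, Thm. 5.8(1)** ("The zero set of `Φ_w` in `\overline{Gw}` equals the boundary
`\overline{Gw} ∖ Gw`"), for a polystable tensor `w` whose degree monoid has a positive element
(`e(w) > 0`; by Thm. 5.3 this always holds for polystable `w ≠ 0`, which is not proved here) and any
`Φ` representing the fundamental invariant (Def. 5.7). Proof: on `Gw`, `Φ(g w) = c Φ(w) = c ≠ 0`;
conversely if `gₖ w → v` with `Φ(v) ≠ 0`, write `gₖ w = τₖ (sₖ w)` with `sₖ ∈ SL³`; then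
`τₖ^{e(w)} = Φ(gₖ w) → Φ(v) ≠ 0`, so along a subsequence `τₖ → τ ≠ 0`, `sₖ w → τ⁻¹ v`, and the
`SL³`-orbit being closed, `τ⁻¹ v ∈ SL³ w`, i.e. `v ∈ Gw` (closure taken in the Euclidean topology, as
in `IsPolystableTensor`). [cite: BurgisserIkenmeyer2017, Thm. 5.8(1)] -/
theorem BI2017_thm_5_8_part1_of_pos [Nonempty ι] (w : ι → ι → ι → ℂ)
    (Φ : MvPolynomial (ι × ι × ι) ℂ) (hps : IsPolystableTensor w)
    (hΦ : IsTensorFundamentalInvariant w Φ) (he : 0 < tensorMinimalDegree w) :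
    ∀ v ∈ closure (tensorGLOrbit w), aeval (tensorPt v) Φ = 0 ↔ v ∉ tensorGLOrbit w := by
  obtain ⟨hΦh, hΦi, hΦw⟩ := hΦ
  intro v hv
  constructor
  · rintro h0 ⟨g, rfl⟩
    obtain ⟨c, hc, hcΦ⟩ := exists_aeval_tensorPt_actTensor_eq_mul hΦh hΦi g w
    rw [hcΦ, hΦw, mul_one] at h0
    exact hc h0
  · intro hnot
    by_contra hne
    apply hnot
    -- a sequence `x k = g_k w → v` in the orbit, `g_k w = τ_k (s_k w)`
    obtain ⟨x, hx, hxv⟩ := mem_closure_iff_seq_limit.1 hv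
    have dec : ∀ k, ∃ (τ : ℂ) (s : Matrix.SpecialLinearGroup ι ℂ × Matrix.SpecialLinearGroup ι ℂ ×
        Matrix.SpecialLinearGroup ι ℂ), τ ≠ 0 ∧
        x k = τ • actTensor (s.1 : Matrix ι ι ℂ) (s.2.1 : Matrix ι ι ℂ) (s.2.2 : Matrix ι ι ℂ) w := by
      intro k
      obtain ⟨g, hg⟩ := hx k
      obtain ⟨τ, s, hτ, hs⟩ := exists_actTensor_eq_smul_sl g w
      exact ⟨τ, s, hτ, hg.trans hs⟩
    choose τ s hτ0 hxs using dec
    -- `Φ(x k) = τ_k ^ e`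
    have hΦx : ∀ k, aeval (tensorPt (x k)) Φ = τ k ^ tensorMinimalDegree w := by
      intro k
      rw [hxs k, show tensorPt (τ k • actTensor ((s k).1 : Matrix ι ι ℂ) ((s k).2.1 : Matrix ι ι ℂ)
          ((s k).2.2 : Matrix ι ι ℂ) w) = τ k • tensorPt (actTensor ((s k).1 : Matrix ι ι ℂ)
          ((s k).2.1 : Matrix ι ι ℂ) ((s k).2.2 : Matrix ι ι ℂ) w) from rfl]
      simp only [MvPolynomial.aeval_eq_eval]
      rw [hΦh.eval_smul_eq, ← MvPolynomial.aeval_eq_eval, hΦi, hΦw, mul_one]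
    -- `τ_k ^ e → Φ(v) ≠ 0`
    have hcont : Continuous fun u : ι → ι → ι → ℂ => aeval (tensorPt u) Φ := by
      simp only [MvPolynomial.aeval_eq_eval]
      exact (MvPolynomial.continuous_eval (p := Φ)).comp (continuous_pi fun p =>
        (continuous_apply p.2.2).comp ((continuous_apply p.2.1).comp (continuous_apply p.1)))
    have hL : Tendsto (fun k => τ k ^ tensorMinimalDegree w) atTop (𝓝 (aeval (tensorPt v) Φ)) :=
      ((hcont.tendsto v).comp hxv).congr fun k => hΦx k
    -- `τ` is bounded; extract a convergent subsequence `τ (φ k) → t`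
    obtain ⟨C, hC⟩ := (Metric.isBounded_range_of_tendsto _ hL).exists_norm_le
    have hbd : ∀ k, τ k ∈ Metric.closedBall (0 : ℂ) (max 1 C) := by
      intro k
      rw [Metric.mem_closedBall, dist_zero_right]
      by_cases h1 : ‖τ k‖ ≤ 1
      · exact h1.trans (le_max_left _ _)
      · have h1' : 1 ≤ ‖τ k‖ := (not_le.1 h1).le
        calc ‖τ k‖ ≤ ‖τ k‖ ^ tensorMinimalDegree w := le_self_pow₀ h1' he.ne'
          _ = ‖τ k ^ tensorMinimalDegree w‖ := (norm_pow _ _).symm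
          _ ≤ C := hC _ ⟨k, rfl⟩
          _ ≤ max 1 C := le_max_right _ _
    obtain ⟨t, -, φ, hφ, hτt⟩ := tendsto_subseq_of_bounded Metric.isBounded_closedBall hbd
    have hte : Tendsto (fun k => τ (φ k) ^ tensorMinimalDegree w) atTop (𝓝 (t ^ tensorMinimalDegree w)) :=
      hτt.pow _
    have hLe : t ^ tensorMinimalDegree w = aeval (tensorPt v) Φ :=
      tendsto_nhds_unique hte (hL.comp hφ.tendsto_atTop)
    have ht0 : t ≠ 0 := by
      rintro rfl
      rw [zero_pow he.ne'] at hLe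
      exact hne hLe.symm
    -- `s_k w = τ_k⁻¹ x_k → t⁻¹ v` along `φ`, and the `SL³`-orbit is closed
    have hsx : ∀ k, actTensor ((s k).1 : Matrix ι ι ℂ) ((s k).2.1 : Matrix ι ι ℂ)
        ((s k).2.2 : Matrix ι ι ℂ) w = (τ k)⁻¹ • x k := by
      intro k
      rw [hxs k, smul_smul, inv_mul_cancel₀ (hτ0 k), one_smul]
    have hlim : Tendsto (fun k => actTensor ((s (φ k)).1 : Matrix ι ι ℂ) ((s (φ k)).2.1 : Matrix ι ι ℂ)
        ((s (φ k)).2.2 : Matrix ι ι ℂ) w) atTop (𝓝 (t⁻¹ • v)) := by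
      simp only [hsx]
      exact (hτt.inv₀ ht0).smul (hxv.comp hφ.tendsto_atTop)
    have hmem : t⁻¹ • v ∈ Set.range (fun g : Matrix.SpecialLinearGroup ι ℂ ×
        Matrix.SpecialLinearGroup ι ℂ × Matrix.SpecialLinearGroup ι ℂ =>
        actTensor (g.1 : Matrix ι ι ℂ) (g.2.1 : Matrix ι ι ℂ) (g.2.2 : Matrix ι ι ℂ) w) :=
      hps.mem_of_tendsto hlim (Eventually.of_forall fun k => ⟨s (φ k), rfl⟩)
    obtain ⟨s₀, hs₀'⟩ := hmem
    have hs₀ : actTensor (s₀.1 : Matrix ι ι ℂ) (s₀.2.1 : Matrix ι ι ℂ) (s₀.2.2 : Matrix ι ι ℂ) w =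
        t⁻¹ • v := hs₀'
    -- `v = t (s₀ w) = ((t s₀,₁) ⊗ s₀,₂ ⊗ s₀,₃)·w ∈ Gw`
    have hd1 : (t • (s₀.1 : Matrix ι ι ℂ)).det ≠ 0 := by
      rw [Matrix.det_smul, Matrix.SpecialLinearGroup.det_coe, mul_one]; exact pow_ne_zero _ ht0
    have hd2 : (s₀.2.1 : Matrix ι ι ℂ).det ≠ 0 := by
      rw [Matrix.SpecialLinearGroup.det_coe]; exact one_ne_zero
    have hd3 : (s₀.2.2 : Matrix ι ι ℂ).det ≠ 0 := by
      rw [Matrix.SpecialLinearGroup.det_coe]; exact one_ne_zero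
    refine ⟨(Matrix.GeneralLinearGroup.mkOfDetNeZero _ hd1, Matrix.GeneralLinearGroup.mkOfDetNeZero _ hd2,
      Matrix.GeneralLinearGroup.mkOfDetNeZero _ hd3), ?_⟩
    simp only [Matrix.GeneralLinearGroup.val_mkOfDetNeZero]
    have hsm := actTensor_smul_smul_smul' t 1 1 (s₀.1 : Matrix ι ι ℂ) (s₀.2.1 : Matrix ι ι ℂ)
      (s₀.2.2 : Matrix ι ι ℂ) w
    rw [one_smul, one_smul, mul_one, mul_one] at hsm
    rw [hsm, hs₀, smul_smul, mul_inv_cancel₀ ht0, one_smul]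

end FundamentalInvariantZeroSet

end Literature.Computability.AlgebraicComplexity
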